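import Summits.Ventures.QEC.Census.CertBZPlaneTop
import Summits.Ventures.QEC.Census.BB.A1s_n192_k8_f203e8ac.Q96Defs
import HarnessLib

set_option Elab.async false
set_option maxRecDepth 200000

/-!
# `[[192,8,16]]` one-level cover certificate of `A1s_n192_k8_f203e8ac` — `u = 0` enumeration, lane families part C (7 of 87 families of the quotient BZ list;
# qec-search-5 `Plane.topOK` replays against the allow-list `hz1`, `decide +kernel`; assembled by `Q96Low`). Theorems only; KERNEL. qec-search-1 g5.
-/

namespace Summit.Ventures.QEC.Census.A1s_n192_k8_f203e8ac

open Matrix Summit.Ventures.QEC.Census Literature.InformationTheory.QuantumCodes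

set_option maxHeartbeats 400000000 in
/-- Matrix 1, family 80: top rows `[37]` fixed, `≤ 6` rows below `37` (2835200 lanes, 1 `H^Z` rows met). -/
theorem u0f0_80 : Plane.topOK 96 7 A1s_n192_k8_f203e8ac.hz1 (giRows q96Gb u0m0) 37 6 15 [37] 21 = true := by
  decide +kernel

set_option maxHeartbeats 400000000 in
/-- Matrix 1, family 81: top rows `[36]` fixed, `≤ 6` rows below `36` (2391496 lanes, 2 `H^Z` rows met). -/
theorem u0f0_81 : Plane.topOK 96 7 A1s_n192_k8_f203e8ac.hz1 (giRows q96Gb u0m0) 36 6 16 [36] 22 = true := by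
  decide +kernel

set_option maxHeartbeats 400000000 in
/-- Matrix 1, family 82: top rows `[35]` fixed, `≤ 6` rows below `35` (2007328 lanes, 2 `H^Z` rows met). -/
theorem u0f0_82 : Plane.topOK 96 7 A1s_n192_k8_f203e8ac.hz1 (giRows q96Gb u0m0) 35 6 17 [35] 22 = true := by
  decide +kernel

set_option maxHeartbeats 400000000 in
/-- Matrix 1, family 83: top rows `[34]` fixed, `≤ 6` rows below `34` (1676116 lanes, 2 `H^Z` rows met). -/
theorem u0f0_83 : Plane.topOK 96 7 A1s_n192_k8_f203e8ac.hz1 (giRows q96Gb u0m0) 34 6 18 [34] 22 = true := by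
  decide +kernel

set_option maxHeartbeats 400000000 in
/-- Matrix 1, family 84: top rows `[33]` fixed, `≤ 6` rows below `33` (1391842 lanes, 2 `H^Z` rows met). -/
theorem u0f0_84 : Plane.topOK 96 7 A1s_n192_k8_f203e8ac.hz1 (giRows q96Gb u0m0) 33 6 19 [33] 22 = true := by
  decide +kernel

set_option maxHeartbeats 400000000 in
/-- Matrix 1, family 85: top rows `[32]` fixed, `≤ 6` rows below `32` (1149017 lanes, 1 `H^Z` rows met). -/
theorem u0f0_85 : Plane.topOK 96 7 A1s_n192_k8_f203e8ac.hz1 (giRows q96Gb u0m0) 32 6 20 [32] 21 = true := by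
  decide +kernel

set_option maxHeartbeats 400000000 in
/-- Matrix 1, family 86: top rows `[]` fixed, `≤ 7` rows below `32` (4514873 lanes, 8 `H^Z` rows met). -/
theorem u0f0_86 : Plane.topOK 96 7 A1s_n192_k8_f203e8ac.hz1 (giRows q96Gb u0m0) 32 7 20 [] 28 = true := by
  decide +kernel


end Summit.Ventures.QEC.Census.A1s_n192_k8_f203e8ac
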